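import Summits.AtomisticToContinuum.HydrodynamicLimit.Theorems.LocalSecondLaw.Negative.FalseWithoutLLN
import Summits.AtomisticToContinuum.HydrodynamicLimit.Theorems.LocalSecondLaw.Negative.FreeVolume
import Summits.AtomisticToContinuum.HydrodynamicLimit.Theorems.LocalSecondLaw.Negative.HomogeneousLLN
import Literature.Analysis.FluidPDE.ConfinedHardSphereFlowShortBad
import Literature.Analysis.FluidPDE.HardSphereAlexander

/-!
# The order-swapped `LocalSecondLaw` (`∃ r₀` after `∀ N`) is FALSE: the quantifier order carries the temperature

Negative knowledge for the crux `JParityClosure.LocalSecondLaw` (stmt-AtomisticToContinuum-13081), from the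
standing disprover's `Cruxes/LocalSecondLaw/Disproof.lean` §(c').  `LocalSecondLawRAfterN` is the crux VERBATIM
except that `∃ r₀ > 0, ∀ r < r₀` is moved AFTER `∃ N₀, ∀ N ≥ N₀` (the mollification scale may shrink with `N`).
Contrast `RateFloor/Negative/RAfterN.lean` (there the swap is junk-TRUE): here it is junk-DECIDED BY THE BOUNDARY
TERM and FALSE (`not_localSecondLawRAfterN`, sorry-free).  For `2r < ε_N` two centres within `r` of one field
point would be `< ε_N` apart (torus triangle inequality), so every ball holds at most one centre, the empirical
temperature `θ_r = (2/3)(e_r/ρ_r - |m_r|²/(2ρ_r²))` VANISHES identically, the guard gives `H(ρ_r, θ_r) = 0`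
(`Hs_rhoC_thetaC_eq_zero_of_sep`), the space–time functional is `0` surely on `Φ.good`
(`entropyFunctional_eq_zero_of_sep`), and the event is `{init < -η}`: for the hot matched equilibrium
`(1, e², 0)` (identified LLN) the boundary term is `f_ex(σ³) - 3 ≤ -1 < -1/2`, probability `1 > 1/2`.
MORAL: the filed order `∃ r₀ ∀ r < r₀ ∃ N₀(r) ∀ N ≥ N₀` — `r` frozen while `ε_N = σ(N+1)^{-1/3} → 0`, so that
`≍ N r³ → ∞` centres sit under each mollifier — is exactly what gives the empirical temperature, hence the crux,
content; any purported proof that never uses `ε_N ≪ r` proves this false variant instead.  refuter-cdisprove-stmt-AtomisticToContinuum-13081-0.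
-/

noncomputable section

namespace Summit.AtomisticToContinuum.HydrodynamicLimit.Theorems.LocalSecondLawNegative

open MeasureTheory Filter Set Topology
open scoped ENNReal
open Literature.MathematicalPhysics.KineticTheory Literature.Analysis.FluidPDE

variable {N : ℕ}

/-- **Singleton balls.**  If the centres are pairwise `≥ ε` apart and `2r < ε`, every field point sees at
most one particle, the empirical temperature vanishes and the guard makes `H(ρ_r, θ_r) = 0`. [folklore] -/
theorem Hs_rhoC_thetaC_eq_zero_of_sep {σ r ε : ℝ} (hr : 0 < r) (h2r : 2 * r < ε)
    {w : Config (N + 1) (Fin 3) T3}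
    (hw : w ∈ hardSphereDomain (Torus.geometry (Fin 3)) (N + 1) ε) (x₀ : T3) :
    Hs σ (rhoC r w x₀) (thetaC r w x₀) = 0 := by
  -- at most one particle within distance `r` of `x₀`
  have huniq : ∀ i j, cone r (w i).1 x₀ ≠ 0 → cone r (w j).1 x₀ ≠ 0 → i = j := by
    intro i j hi hj
    by_contra hij
    have hdi : Torus.euclidDist (w i).1 x₀ < r := by
      by_contra hle
      exact hi (by
        unfold cone
        rw [max_eq_right, mul_zero]
        rw [not_lt] at hle
        have : 1 ≤ Torus.euclidDist (w i).1 x₀ / r := by rwa [le_div_iff₀ hr, one_mul]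
        linarith)
    have hdj : Torus.euclidDist (w j).1 x₀ < r := by
      by_contra hle
      exact hj (by
        unfold cone
        rw [max_eq_right, mul_zero]
        rw [not_lt] at hle
        have : 1 ≤ Torus.euclidDist (w j).1 x₀ / r := by rwa [le_div_iff₀ hr, one_mul]
        linarith)
    have hsep := hw i j hij
    rw [Torus.norm_geometry_sepVec] at hsep
    have htri := Torus.euclidDist_triangle (w i).1 x₀ (w j).1
    rw [Torus.euclidDist_comm x₀] at htri
    linarith
  unfold Hs
  rw [if_neg]
  rintro ⟨hρ, hθ⟩
  -- a particle is present
  have hρsum : rhoC r w x₀ = ((N + 1 : ℕ) : ℝ)⁻¹ * ∑ i, cone r (w i).1 x₀ := by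
    unfold rhoC; rw [integral_empiricalMeasure]
  obtain ⟨i₀, -, hi₀⟩ : ∃ i₀ ∈ (Finset.univ : Finset (Fin (N + 1))), cone r (w i₀).1 x₀ ≠ 0 := by
    by_contra hall
    push Not at hall
    have : rhoC r w x₀ = 0 := by
      rw [hρsum, Finset.sum_eq_zero fun i _ => hall i (Finset.mem_univ i), mul_zero]
    linarith
  have hothers : ∀ j, j ≠ i₀ → cone r (w j).1 x₀ = 0 := fun j hj => by
    by_contra hne
    exact hj (huniq j i₀ hne hi₀)
  set c := cone r (w i₀).1 x₀ with hc
  set v := (w i₀).2 with hv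
  have hρ1 : rhoC r w x₀ = ((N + 1 : ℕ) : ℝ)⁻¹ * c := by
    rw [hρsum, Finset.sum_eq_single i₀ (fun j _ hj => hothers j hj) (fun h => absurd (Finset.mem_univ _) h)]
  have hk1 : kinC r w x₀ = ((N + 1 : ℕ) : ℝ)⁻¹ * (c * (‖v‖ ^ 2 / 2)) := by
    rw [kinC_eq_sum, Finset.sum_eq_single i₀ (fun j _ hj => by rw [hothers j hj, zero_mul])
      (fun h => absurd (Finset.mem_univ _) h)]
  have hm1 : momC r w x₀ = ((N + 1 : ℕ) : ℝ)⁻¹ • (c • v) := by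
    show empiricalMomentumField w (fun y => cone r y x₀) = _
    rw [empiricalMomentumField_eq_sum, Finset.sum_eq_single i₀ (fun j _ hj => by
      show cone r (w j).1 x₀ • (w j).2 = 0
      rw [hothers j hj, zero_smul]) (fun h => absurd (Finset.mem_univ _) h)]
  have hcpos : 0 < c := lt_of_le_of_ne (cone_nonneg hr _ _) (Ne.symm hi₀)
  have hθ0 : thetaC r w x₀ = 0 := by
    unfold thetaC
    rw [hρ1, hk1, hm1, norm_smul, norm_smul, Real.norm_eq_abs, Real.norm_eq_abs,
      abs_of_nonneg (by positivity : (0 : ℝ) ≤ ((N + 1 : ℕ) : ℝ)⁻¹), abs_of_nonneg hcpos.le]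
    have hN : (0 : ℝ) < ((N + 1 : ℕ) : ℝ)⁻¹ := by positivity
    field_simp
    ring
  rw [hθ0] at hθ
  exact lt_irrefl _ hθ

/-- On the good set, with `2r < ε_N`, the crux functional VANISHES for every test function (every ball is a
singleton ball along the whole trajectory). [folklore] -/
theorem entropyFunctional_eq_zero_of_sep {σ r : ℝ} (hr : 0 < r) {N : ℕ} (h2r : 2 * r < hsDiameter σ N)
    (Φ : HardSphereFlow (Torus.geometry (Fin 3)) (hsDiameter σ N) (N + 1)) (τ : ℝ) (φ : ℝ → T3 → ℝ)
    {z : Config (N + 1) (Fin 3) T3} (hz : z ∈ Φ.good) :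
    entropyFunctional σ r τ φ Φ z = 0 := by
  unfold entropyFunctional
  have h : ∀ s x, Hs σ (rhoC r (Φ.flow s z) x) (thetaC r (Φ.flow s z) x) = 0 := fun s x =>
    Hs_rhoC_thetaC_eq_zero_of_sep hr h2r (Φ.good_subset (Φ.mapsTo_good s hz)) x
  simp [h]

/-- The crux `LocalSecondLaw` VERBATIM with `∃ r₀ …` moved AFTER `∀ N ≥ N₀` (the mollification scale may shrink
with `N`). -/
def LocalSecondLawRAfterN : Prop :=
  ∀ (a₀ θ₀ : Literature.MathematicalPhysics.KineticTheory.T3 → ℝ) (u₀ : Literature.MathematicalPhysics.KineticTheory.T3 → Literature.MathematicalPhysics.KineticTheory.V3), Continuous a₀ → Continuous θ₀ → Continuous u₀ → (∀ x, 0 < a₀ x) → (∀ x, 0 < θ₀ x) → ∃ σ₀ : ℝ, 0 < σ₀ ∧ ∀ σ : ℝ, 0 < σ → σ < σ₀ → ∀ (T : ℝ) (ρ θ : ℝ → Literature.MathematicalPhysics.KineticTheory.T3 → ℝ) (u : ℝ → Literature.MathematicalPhysics.KineticTheory.T3 → Literature.MathematicalPhysics.KineticTheory.V3), Literature.MathematicalPhysics.KineticTheory.IsHardSphereEulerSolution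 σ T ρ u θ → ∀ Φ : (N : ℕ) → Literature.Analysis.FluidPDE.HardSphereFlow (Literature.Analysis.FluidPDE.Torus.geometry (Fin 3)) (Literature.MathematicalPhysics.KineticTheory.hsDiameter σ N) (N + 1), Literature.MathematicalPhysics.KineticTheory.TendstoHydroFieldsAt (fun N => Literature.MathematicalPhysics.KineticTheory.localGibbsLaw σ a₀ u₀ θ₀ N (Φ N)) Φ ρ u θ 0 → 0 < T → ∀ τ : ℝ, 0 < τ → ∀ φ : ℝ → Literature.MathematicalPhysics.KineticTheory.T3 → ℝ, Literature.Analysis.FunctionSpaces.Torus.IsSmoothSpaceTimeOn Set.univ φ → (∀ s x, 0 ≤ φ s x) → (∃ τ' : ℝ, τ' < τ ∧ ∀ s, τ' ≤ s → ∀ x, φ s x = 0) → ∀ η δ : ℝ, 0 < η → 0 < δ → ∃ N₀ : ℕ, ∀ N : ℕ, N₀ ≤ N → ∃ r₀ : ℝ, 0 < r₀ ∧ ∀ r : ℝ, 0 < r → r < r₀ → let γ : Literature.Analysis.FluidPDE.Config (N + 1) (Fin 3) Literature.MathematicalPhysics.KineticTheory.T3 → ℝ → Literature.Analysis.FluidPDE.Config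 (N + 1) (Fin 3) Literature.MathematicalPhysics.KineticTheory.T3 := fun z s => (Φ N).flow s z; let bx : Literature.MathematicalPhysics.KineticTheory.T3 → Literature.MathematicalPhysics.KineticTheory.T3 → ℝ := fun x y => 3 / (Real.pi * r ^ 3) * max (1 - Literature.Analysis.FluidPDE.Torus.euclidDist x y / r) 0; let ρm : Literature.Analysis.FluidPDE.Config (N + 1) (Fin 3) Literature.MathematicalPhysics.KineticTheory.T3 → ℝ → Literature.MathematicalPhysics.KineticTheory.T3 → ℝ := fun z s x₀ => ∫ q, bx q.1 x₀ ∂(Literature.Analysis.FluidPDE.empiricalMeasure (γ z s)); let mm : Literature.Analysis.FluidPDE.Config (N + 1) (Fin 3) Literature.MathematicalPhysics.KineticTheory.T3 → ℝ → Literature.MathematicalPhysics.KineticTheory.T3 → Literature.MathematicalPhysics.KineticTheory.V3 := fun z s x₀ => ∫ q, bx q.1 x₀ • q.2 ∂(Literature.Analysis.FluidPDE.empiricalMeasure (γ z s)); let em : Literature.Analysis.FluidPDE.Config (N + 1) (Fin 3) Literature.MathematicalPhysics.KineticTheory.T3 → ℝ → Literature.MathematicalPhysics.KineticTheory.T3 →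 ℝ := fun z s x₀ => ∫ q, bx q.1 x₀ * (‖q.2‖ ^ 2 / 2) ∂(Literature.Analysis.FluidPDE.empiricalMeasure (γ z s)); let θm : Literature.Analysis.FluidPDE.Config (N + 1) (Fin 3) Literature.MathematicalPhysics.KineticTheory.T3 → ℝ → Literature.MathematicalPhysics.KineticTheory.T3 → ℝ := fun z s x₀ => 2 / 3 * (em z s x₀ / ρm z s x₀ - ‖mm z s x₀‖ ^ 2 / (2 * ρm z s x₀ ^ 2)); let Hs : ℝ → ℝ → ℝ := fun a b => if 0 < a ∧ 0 < b then -(a * (3 / 2 * Real.log b - Real.log a - Literature.MathematicalPhysics.KineticTheory.hsExcessFreeEnergy (a * σ ^ 3))) else 0; let I : Literature.Analysis.FluidPDE.Config (N + 1) (Fin 3) Literature.MathematicalPhysics.KineticTheory.T3 → ℝ := fun z => ∫ s in Set.Icc (0 : ℝ) τ, ∫ x : Literature.MathematicalPhysics.KineticTheory.T3, Hs (ρm z s x) (θm z s x) * (deriv (fun s' => φ s' x) s + ∑ k : Fin 3, (mm z s x) k / ρm z s x * Literature.Analysis.FunctionSpaces.Torus.partialDeriv k (φ s) x); Literature.MathematicalPhysics.KineticTheory.localGibbsLaw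 σ a₀ u₀ θ₀ N (Φ N) {z | I z + ∫ x : Literature.MathematicalPhysics.KineticTheory.T3, Hs (ρ 0 x) (θ 0 x) * φ 0 x < -η} ≤ ENNReal.ofReal δ

/-- **The order-swapped `LocalSecondLaw` is FALSE** (contrast `RateFloor/Negative/RAfterN.lean`, where the
swapped order is junk-TRUE): for `2r < ε_N` the functional vanishes surely on `Φ.good`
(`entropyFunctional_eq_zero_of_sep`) and the event is decided by the boundary term alone — for the hot matched
equilibrium `(1, e², 0)` it is `f_ex(σ³) - 3 ≤ -1 < -1/2` surely, probability `1 > 1/2`.  So the filed order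
`∃ r₀ ∀ r < r₀ ∃ N₀(r)` (mollifier frozen while `ε_N → 0`, `N r³ → ∞` particles per ball) is exactly what gives
the empirical temperature — and the crux — content; any purported proof that never uses `ε_N ≪ r` proves a
false statement. [folklore] -/
theorem not_localSecondLawRAfterN : ¬ LocalSecondLawRAfterN := by
  intro h
  set θ₀ : ℝ := Real.exp 2 with hθ₀
  have hθ₀pos : 0 < θ₀ := Real.exp_pos 2
  have hc1 : Continuous (fun _ : T3 => (1 : ℝ)) := continuous_const
  have hcθ : Continuous (fun _ : T3 => θ₀) := continuous_const
  have hc0 : Continuous (fun _ : T3 => (0 : V3)) := continuous_const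
  obtain ⟨σ₀, hσ₀, h1⟩ := h (fun _ => 1) (fun _ => θ₀) (fun _ => 0) hc1 hcθ hc0
    (fun _ => one_pos) (fun _ => hθ₀pos)
  obtain ⟨σ₁, hσ₁, -, hL⟩ := homogeneous_lln_identified hθ₀pos
  obtain ⟨σ, hσpos, hσlt0, hσlt1, hσhalf⟩ : ∃ σ : ℝ, 0 < σ ∧ σ < σ₀ ∧ σ < σ₁ ∧ σ < 2⁻¹ := by
    refine ⟨min (min σ₀ σ₁) 2⁻¹ / 2, by positivity, ?_, ?_, ?_⟩ <;>
      linarith [min_le_left (min σ₀ σ₁) (2⁻¹ : ℝ), min_le_right (min σ₀ σ₁) (2⁻¹ : ℝ),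
        min_le_left σ₀ σ₁, min_le_right σ₀ σ₁, lt_min (lt_min hσ₀ hσ₁) (show (0 : ℝ) < 2⁻¹ by norm_num)]
  have hσhalf' : σ ≤ 1 / 2 := by rw [one_div]; exact hσhalf.le
  let Φ : (N : ℕ) → HardSphereFlow (Torus.geometry (Fin 3)) (hsDiameter σ N) (N + 1) := fun N =>
    Classical.choice (HardSphereFlow.nonempty_torus_holds (d := Fin 3) (hsDiameter_pos hσpos N)
      (lt_of_le_of_lt (hsDiameter_le hσpos.le N) hσhalf) (N + 1))
  have hT := hL σ hσpos hσlt1 Φ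
  have hsol := constState_isSolution σ 1 hθ₀pos
  have hsmooth : Literature.Analysis.FunctionSpaces.Torus.IsSmoothSpaceTimeOn Set.univ
      (fun (s : ℝ) (_ : T3) => psi s) := by
    show ContDiffOn ℝ _ (fun p : ℝ × EuclideanSpace ℝ (Fin 3) => psi p.1) _
    exact (psi_contDiff.comp contDiff_fst).contDiffOn
  obtain ⟨N₀, h3⟩ := h1 σ hσpos hσlt0 1 (fun _ _ => 1) (fun _ _ => θ₀) (fun _ _ => 0) hsol Φ hT
    one_pos 1 one_pos (fun s _ => psi s) hsmooth (fun s _ => psi_nonneg s)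
    ⟨1 / 2, by norm_num, fun s hs _ => psi_eq_zero hs⟩ (1 / 2) (1 / 2) (by norm_num) (by norm_num)
  obtain ⟨r₀, hr₀, h4⟩ := h3 N₀ le_rfl
  have hε := hsDiameter_pos hσpos N₀
  set r : ℝ := min (r₀ / 2) (hsDiameter σ N₀ / 4) with hr
  have hrpos : 0 < r := by positivity
  have hrlt : r < r₀ := lt_of_le_of_lt (min_le_left _ _) (by linarith)
  have h2r : 2 * r < hsDiameter σ N₀ := by
    have := min_le_right (r₀ / 2) (hsDiameter σ N₀ / 4); linarith
  have h5 := h4 r hrpos hrlt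
  change localGibbsLaw σ (fun _ => 1) (fun _ => 0) (fun _ => θ₀) N₀ (Φ N₀)
      {z | entropyFunctional σ r 1 (fun s _ => psi s) (Φ N₀) z +
        ∫ x : T3, Hs σ ((fun _ _ => (1 : ℝ)) 0 x) ((fun _ _ => θ₀) 0 x) *
          (fun (s : ℝ) (_ : T3) => psi s) 0 x < -(1 / 2)} ≤ ENNReal.ofReal (1 / 2) at h5
  haveI : IsProbabilityMeasure (localGibbsLaw σ (fun _ => 1) (fun _ => 0) (fun _ => θ₀) N₀ (Φ N₀)) :=
    isProbabilityMeasure_localGibbsLaw hc1 hcθ hc0 (fun _ => one_pos) (fun _ => hθ₀pos) hσhalf' N₀ (Φ N₀)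
  have hHs : Hs σ 1 θ₀ = hsExcessFreeEnergy (1 * σ ^ 3) - 3 := by
    unfold Hs
    rw [if_pos ⟨one_pos, hθ₀pos⟩, Real.log_one, hθ₀, Real.log_exp]
    ring
  have hinit : (∫ x : T3, Hs σ ((fun _ _ => (1 : ℝ)) 0 x) ((fun _ _ => θ₀) 0 x) *
      (fun (s : ℝ) (_ : T3) => psi s) 0 x) = hsExcessFreeEnergy (1 * σ ^ 3) - 3 := by
    show (∫ _ : T3, Hs σ 1 θ₀ * psi 0) = _
    rw [integral_const, psi_zero, mul_one, hHs]
    simp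
  have hf2 : hsExcessFreeEnergy (1 * σ ^ 3) ≤ 2 := by
    rw [one_mul]; exact hsExcessFreeEnergy_le_two hσpos.le hσhalf'
  have hgood : (Φ N₀).good ⊆ {z | entropyFunctional σ r 1 (fun s _ => psi s) (Φ N₀) z +
        ∫ x : T3, Hs σ ((fun _ _ => (1 : ℝ)) 0 x) ((fun _ _ => θ₀) 0 x) *
          (fun (s : ℝ) (_ : T3) => psi s) 0 x < -(1 / 2)} := by
    intro z hz
    rw [Set.mem_setOf_eq, entropyFunctional_eq_zero_of_sep hrpos h2r (Φ N₀) 1 _ hz, hinit]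
    linarith
  have hg1 : localGibbsLaw σ (fun _ => 1) (fun _ => 0) (fun _ => θ₀) N₀ (Φ N₀) (Φ N₀).good = 1 := by
    have hac : localGibbsLaw σ (fun _ => 1) (fun _ => 0) (fun _ => θ₀) N₀ (Φ N₀) ≪
        liouville (Torus.geometry (Fin 3)) (N₀ + 1) (hsDiameter σ N₀) :=
      withDensity_absolutelyContinuous _ _
    have h0 : localGibbsLaw σ (fun _ => 1) (fun _ => 0) (fun _ => θ₀) N₀ (Φ N₀) ((Φ N₀).good)ᶜ = 0 :=
      hac (Φ N₀).measure_compl_good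
    have := prob_add_prob_compl (μ := localGibbsLaw σ (fun _ => 1) (fun _ => 0) (fun _ => θ₀) N₀ (Φ N₀))
      (Φ N₀).measurableSet_good
    rwa [h0, add_zero] at this
  have h6 : (1 : ℝ≥0∞) ≤ ENNReal.ofReal (1 / 2) := by
    rw [← hg1]; exact (measure_mono hgood).trans h5
  have h7 : (1 : ℝ≥0∞).toReal ≤ 1 / 2 := ENNReal.toReal_le_of_le_ofReal (by norm_num) h6
  norm_num at h7


end Summit.AtomisticToContinuum.HydrodynamicLimit.Theorems.LocalSecondLawNegative

end
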